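import Literature.IUT.HodgeArakelov.EtaleThetaDataOfSettingRootHypTransport
import Literature.AnabelianGeometry.EtaleTheta.XuuCocycleOfClassLevel
import Literature.AnabelianGeometry.EtaleTheta.Discharge.Sec1ThetaCompanionOfAut

/-!
# GAP row G-w5d169-2, step (E4): from the [EtTh] Thm 1.6 (iii) CORE IDENTITY `transport(η̈^Θ) = k · conj_σ(η̈^Θ)`
# to the consumer shape `transport(η̈^Θ) = conj_τ(η̈^Θ)`, `τ ∈ Π^tp_X̲̲` — the sign goes into the `μ₂` of `Π^tp_X̲̲/Π^tp_Ÿ̲̲`,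
# the `Π^tp_Ÿ`-part of `σ` acts trivially

S. Mochizuki, *The étale theta function …*, Publ. RIMS **45** (2009) [EtTh] (refereed): Thm. 1.6 (iii) p. 24 and its proof
p. 25 (the core identity with an `O^×_{K̈}`-multiple), Thm. 1.10 (i) p. 29 ("of standard type … a property that determines
this collection of classes up to multiplication by `±1`"), Prop. 1.4 (ii) p. 22 ("`Θ̈(−Ü) = −Θ̈(Ü)`"), Prop. 1.5 (ii) p. 23,
Def. 2.7 / Cor. 2.9 pp. 41–43 (labels; the `(l·ℤ × μ₂)`-orbit `η̈^{Θ,l·ℤ×μ₂}`) [cite: MochizukiEtTh2009, Thm 1.6 (iii) p.24].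
S. Mochizuki, *Inter-universal Teichmüller theory II*, Prop. 1.4 p. 27 (claim key `Mochizuki2012`, DISPUTED, D-0012).

abc-iut cell, seat abc-iut-w6-d002 (gen 2); route of record D-G-w5d169-2 (memo `HOME/staging/w6/w6-d002/SCOPE-G-w5d169-2.md`),
after abc-iut-w4-d041's (E5) glue `EtaleThetaDataOfSettingRootHypDelta/Transport.lean` (p436508/p436936), whose consumer
hypothesis is «`transport c h (η̈^Θ) = conj_τ (η̈^Θ)`, `τ ∈ Π^tp_X̲̲`» (`rootHyp_of_transport_eq_conj'`).  The Thm 1.6 (iii)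
sub-DAG of L2 (`Thm16Sub.thm16iii_of_core`, input `heta`) delivers instead the CORE IDENTITY
«`transport c h (η̈^Θ) = k · conj_σ (η̈^Θ)`, `k ∈ κ(O^×_{K̈})`, `σ ∈ Π^tp_X`».  THIS FILE (proof-only; no definition, no
`Prop`-valued definition, no named fact) closes the gap between the two shapes from three print-named inputs, each an
explicit binder:
* (UNIT) `k = 1 ∨ k = m` for a unit class `m ∈ κ(O^×_{K̈})` — Thm. 1.10 (i): standard type pins the multiple to `±1`
  (`m` = the Kummer class of `−1`);
* (SIGN) `conj_{ι₂} (η̈^Θ) = m · η̈^Θ` for some `ι₂ ∈ Π^tp_X̲̲` — Prop. 1.4 (ii) `Θ̈(−Ü) = −Θ̈(Ü)` for the deck transformation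
  of `Ÿ → Y`, i.e. the `μ₂` of `Π^tp_X̲̲/Π^tp_Ÿ̲̲ ≅ l·ℤ × μ₂` (Def. 2.7);
* (LABEL) `σ ∈ Π^tp_X̲̲ · Π^tp_Ÿ` — the zero-label clause: an automorphism extending one of `Π^tp_X̲̲` keeps `η̈^Θ` in its
  `l·ℤ`-coset of the `Z`-orbit (Cor. 2.9 / [IUTchII] Cor. 2.4); the `Π^tp_Ÿ`-factor acts trivially on `H¹(Π^tp_Ÿ, Δ_Θ)`
  (inner automorphisms, abc-iut-L6-t12's `ContH1.conj_eq_self_of_mem`).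
WHY the sign cannot be left in the `l`-torsion `ε` of `hroot`: its `Δ_Θ`-shadow would be `κ(−1)|_{Π^tp_Ÿ̲̲}`, and
`κ(−1)^l = κ(−1) ≠ 1` for `l` odd — so `l • ε ≠ 0`; the sign MUST be absorbed by the `μ₂`-conjugation.
* `transport_eq_conj_of_core` — the [EtTh]-level assembly (pure `H¹(Π^tp_Ÿ, Δ_Θ)` algebra; units are `Π^tp_X`-inert by
  abc-iut-w5-d234's `conj_eq_self_of_mem_kumUnitsYdd`, i.e. Prop. 1.5 (ii) under `K = K̈`);
* **`rootHyp_of_forall_extends_core`** — `hroot` (GAP row G-w5d169-2, binder (P4) of [IUTchII] Prop 3.4 (i) at the genuine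
  functor) from, per `α`: (E1) an extension `γ ⊇ α` with `Thm16i γ`, (E2) a theta companion `c`, (E3) the core identity at
  `(γ, c)`, (UNIT), (SIGN), (LABEL) — every input a printed [EtTh] §1–§2 statement in L2's own vocabulary.
Nothing here asserts anything of [EtTh] or [IUTchII] beyond what is proved; no side taken on [IUTchIII] Cor. 3.12; typed ≠ proved.
-/

noncomputable section

open Topology

namespace Literature.AnabelianGeometry.EtaleTheta

namespace ThetaSetting.EtaleThetaData

variable {p : ℕ} [Fact p.Prime] {D : ThetaSetting p} (E : D.EtaleThetaData)

/-- **From the Thm 1.6 (iii) core identity to a plain conjugate.**  If `transport c h (η̈^Θ) = k · conj_σ (η̈^Θ)` with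
`k ∈ κ(O^×_{K̈})`, where (UNIT) `k = 1` or `k = m`, (SIGN) `conj_{ι₂} (η̈^Θ) = m · η̈^Θ`, and (LABEL) `σ = τ₀ · y` with
`y ∈ Π^tp_Ÿ`, then `transport c h (η̈^Θ) = conj_τ (η̈^Θ)` for `τ = τ₀` or `τ = τ₀ · ι₂` (units are `Π^tp_X`-inert, Prop 1.5
(ii); `Π^tp_Ÿ` acts trivially on `H¹(Π^tp_Ÿ, Δ_Θ)`). [cite: MochizukiEtTh2009, Thm 1.6 (iii) p.25] -/
theorem transport_eq_conj_of_core {γ : D.PiTemp ≃ₜ* D.PiTemp} (h : ThetaSetting.Thm16i γ)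
    (c : ThetaSetting.ThetaCompanion γ) (hC : D.Compat) (hS : D.Sec2Hyps) (h15ii : Prop15ii E.toKummerData hC)
    {k m : D.H1 D.GtpYdd} (hm : m ∈ E.kumUnitsYdd) {σ τ₀ ι₂ y : D.PiTemp} (hy : y ∈ D.GtpYdd)
    (heta : haveI := hC.GtpYdd_normal
      ThetaSetting.transport c h E.etaDd = k * ContH1.conj D.toTheta D.DeltaTheta σ E.etaDd)
    (hunit : k = 1 ∨ k = m)
    (hsign : haveI := hC.GtpYdd_normal
      ContH1.conj D.toTheta D.DeltaTheta ι₂ E.etaDd = m * E.etaDd)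
    (hlabel : σ = τ₀ * y) :
    haveI := hC.GtpYdd_normal
    ∃ τ : D.PiTemp, (τ = τ₀ ∨ τ = τ₀ * ι₂) ∧
      ThetaSetting.transport c h E.etaDd = ContH1.conj D.toTheta D.DeltaTheta τ E.etaDd := by
  haveI := hC.GtpYdd_normal
  have hστ : ContH1.conj D.toTheta D.DeltaTheta σ E.etaDd = ContH1.conj D.toTheta D.DeltaTheta τ₀ E.etaDd := by
    rw [hlabel, ContH1.conj_mul_apply, ContH1.conj_eq_self_of_mem y hy]
  rcases hunit with rfl | rfl
  · exact ⟨τ₀, Or.inl rfl, by rw [heta, one_mul, hστ]⟩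
  · refine ⟨τ₀ * ι₂, Or.inr rfl, ?_⟩
    rw [heta, hστ, ContH1.conj_mul_apply, hsign, map_mul, conj_eq_self_of_mem_kumUnitsYdd hC hS h15ii hm τ₀]

end ThetaSetting.EtaleThetaData

end Literature.AnabelianGeometry.EtaleTheta

namespace Literature.IUT.HodgeArakelov

namespace EtaleThetaDataOfSetting

open Literature.AnabelianGeometry.EtaleTheta CohomologySystemOfContH1

variable {p : ℕ} [Fact p.Prime] {D : Literature.AnabelianGeometry.EtaleTheta.ThetaSetting p}
  {E : D.EtaleThetaData} {l : ℕ} (C : E.DoubleUnderline l)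

/-- **`hroot` (GAP row G-w5d169-2) from the print-named [EtTh] §1–§2 inputs**, per `α ∈ Aut_top(Π^tp_X̲̲)`: (E1) an extension
`γ ∈ Aut_top(Π^tp_X)` of `α` with `Thm16i γ` (Prop. 2.4, Thm. 1.6 (i)); (E2) a theta companion `c` (Thm. 1.6 (ii)); (E3) the
Thm. 1.6 (iii) core identity `transport c h (η̈^Θ) = k · conj_σ (η̈^Θ)`, `k ∈ κ(O^×_{K̈})`; (UNIT) `k ∈ {1, m}` (Thm. 1.10 (i));
(SIGN) `conj_{ι₂} (η̈^Θ) = m · η̈^Θ` with `ι₂ ∈ Π^tp_X̲̲` (Prop. 1.4 (ii)); (LABEL) `σ ∈ Π^tp_X̲̲ · Π^tp_Ÿ` (zero label) — assembled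
through abc-iut-w4-d041's `rootHyp_of_transport_eq_conj'`. [cite: MochizukiEtTh2009, Cor 2.19(iii) p.65] -/
theorem rootHyp_of_forall_extends_core [(PiYdd C).Normal] (hq : IsQuotientMap D.toTheta)
    {N : ℕ+} (μ : D.CyclotomeMod l N) (hC : D.Compat) (hS : D.Sec2Hyps) (h15 : D.Prop15iii E hC) (L : C.CuspLabels)
    (R : RigidData.{0} N l) (hR : R = C.rigidData μ hC hS h15 L) (h218i : R.Cor218_i)
    (h15ii : ThetaSetting.Prop15ii E.toKummerData hC) {m : D.H1 D.GtpYdd} (hm : m ∈ E.kumUnitsYdd)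
    (hsign : ∃ ι₂ : Pi C, haveI := hC.GtpYdd_normal
      ContH1.conj D.toTheta D.DeltaTheta (ι₂ : D.PiTemp) E.etaDd = m * E.etaDd)
    (hE : ∀ α : (Pi C) ≃ₜ* (Pi C), ∃ (γ : D.PiTemp ≃ₜ* D.PiTemp)
      (_ : ∀ x : Pi C, ((α x : Pi C) : D.PiTemp) = γ (x : D.PiTemp)) (h : ThetaSetting.Thm16i γ)
      (c : ThetaSetting.ThetaCompanion γ) (k : D.H1 D.GtpYdd) (σ : D.PiTemp),
      haveI := hC.GtpYdd_normal
      ThetaSetting.transport c h E.etaDd = k * ContH1.conj D.toTheta D.DeltaTheta σ E.etaDd ∧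
        (k = 1 ∨ k = m) ∧ ∃ (τ₀ : Pi C) (y : D.PiTemp), y ∈ D.GtpYdd ∧ σ = (τ₀ : D.PiTemp) * y)
    (α : (Pi C) ≃ₜ* (Pi C)) :
    ∃ τ : Pi C, ∃ ε : (coh C).H1 ⊤, l • ε = 0 ∧
      autActTopOfCor218i C hq μ hC hS h15 L R hR h218i α (rootTop C) =
        h1TopConjEquiv (phi C) (D.lDeltaTheta l) (PiYdd C) τ (rootTop C) + ε := by
  haveI := hC.GtpYdd_normal
  obtain ⟨ι₂, hι₂⟩ := hsign
  obtain ⟨γ, hext, h, c, k, σ, heta, hunit, τ₀, y, hy, hlabel⟩ := hE α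
  obtain ⟨τ, hτ, hT⟩ := E.transport_eq_conj_of_core h c hC hS h15ii hm hy heta hunit hι₂ hlabel
  rcases hτ with rfl | rfl
  · exact rootHyp_of_transport_eq_conj' C α γ hext h c hq μ hC hS h15 L R hR h218i τ₀ hT
  · exact rootHyp_of_transport_eq_conj' C α γ hext h c hq μ hC hS h15 L R hR h218i (τ₀ * ι₂) hT

/-- **(E2) SUPPLIED by construction**: with the companion of an extension `γ ⊇ α` taken to be abc-iut-w5-d072's CONSTRUCTED
`ThetaSetting.thetaCompanionOfAut γ hΔ hq` ([EtTh] Thm. 1.6 (ii) for `γ(Δ^tp_X) = Δ^tp_X`, `Discharge/Sec1ThetaCompanionOfAut.lean`),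
`hroot` follows, per `α`, from (E1′) an extension `γ` with `Thm16i γ` AND `γ(Δ^tp_X) = Δ^tp_X` — the one [EtTh] Prop. 2.4-shape
statement (= hypothesis (a) of abc-iut-L2-d1's `rigidData_cor218_i_of_extends`; G-L6d6-2 family) — together with (E3) the core
identity at that companion, (UNIT), (LABEL), and the global (SIGN).  Residual list of G-w5d169-2 without a separate (E2).
[cite: MochizukiEtTh2009, Thm 1.6 (ii) p.24] -/
theorem rootHyp_of_forall_extends_core_deltaStable [(PiYdd C).Normal] (hq : IsQuotientMap D.toTheta)
    {N : ℕ+} (μ : D.CyclotomeMod l N) (hC : D.Compat) (hS : D.Sec2Hyps) (h15 : D.Prop15iii E hC) (L : C.CuspLabels)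
    (R : RigidData.{0} N l) (hR : R = C.rigidData μ hC hS h15 L) (h218i : R.Cor218_i)
    (h15ii : ThetaSetting.Prop15ii E.toKummerData hC) {m : D.H1 D.GtpYdd} (hm : m ∈ E.kumUnitsYdd)
    (hsign : ∃ ι₂ : Pi C, haveI := hC.GtpYdd_normal
      ContH1.conj D.toTheta D.DeltaTheta (ι₂ : D.PiTemp) E.etaDd = m * E.etaDd)
    (hE : ∀ α : (Pi C) ≃ₜ* (Pi C), ∃ (γ : D.PiTemp ≃ₜ* D.PiTemp)
      (_ : ∀ x : Pi C, ((α x : Pi C) : D.PiTemp) = γ (x : D.PiTemp)) (h : ThetaSetting.Thm16i γ)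
      (hΔ : D.DeltaTemp.map γ.toMulEquiv.toMonoidHom = D.DeltaTemp) (k : D.H1 D.GtpYdd) (σ : D.PiTemp),
      haveI := hC.GtpYdd_normal
      ThetaSetting.transport (D.thetaCompanionOfAut γ hΔ hq) h E.etaDd =
          k * ContH1.conj D.toTheta D.DeltaTheta σ E.etaDd ∧
        (k = 1 ∨ k = m) ∧ ∃ (τ₀ : Pi C) (y : D.PiTemp), y ∈ D.GtpYdd ∧ σ = (τ₀ : D.PiTemp) * y)
    (α : (Pi C) ≃ₜ* (Pi C)) :
    ∃ τ : Pi C, ∃ ε : (coh C).H1 ⊤, l • ε = 0 ∧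
      autActTopOfCor218i C hq μ hC hS h15 L R hR h218i α (rootTop C) =
        h1TopConjEquiv (phi C) (D.lDeltaTheta l) (PiYdd C) τ (rootTop C) + ε := by
  refine rootHyp_of_forall_extends_core C hq μ hC hS h15 L R hR h218i h15ii hm hsign (fun α' => ?_) α
  obtain ⟨γ, hext, h, hΔ, k, σ, hrest⟩ := hE α'
  exact ⟨γ, hext, h, D.thetaCompanionOfAut γ hΔ hq, k, σ, hrest⟩

end EtaleThetaDataOfSetting

end Literature.IUT.HodgeArakelov

end
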